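import Summits.Ventures.PercRepro.CatBot
import Summits.Ventures.PercRepro.CatReach
import Summits.Ventures.PercRepro.CatMoebius
import Summits.Ventures.PercRepro.FibreProductCount

/-!
# Branch catalogues — the facts, the weight and the cell count (module 7)

Seven FACTS of a configuration in mode `μ` with avoided mark `X`: the six detours `Dloc μ X i j`
of the pairs of terminals, carried by some branch, and the WITNESS (some branch attaches the
mark of `μ`).  In mode `μ`, «`InMode μ` and the event `ev`» depends on a configuration only through
its fact vector (`Wcat μ ev`: the witness condition and `reach4` of the detour matrix), so by Möbius
inversion (`sum_weight_eq_moebius`) and the product count (`card_filter_fibres_eq_prod`) the number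
of configurations in mode `μ` with the event `ev` is the CELL POLYNOMIAL
`∑ U, moebius (Wcat μ ev) U · ∏ τ, cT μ X U τ ^ m τ` (`card_mode_event_eq_cellPoly`), where
`cT μ X U τ` counts the states of a branch of type `τ` allowed in mode `μ` carrying no fact of `U`.
-/

namespace PercRepro.CatGraph

open MultiGraph StarGadgetGraph Finset

/-! ### The three events and the fact vector (catalogue-free) -/

/-- The three H-events of the D-free inequality. -/
inductive Ev
  /-- `c ~_H a` avoiding the cluster of `b`. -/
  | o1
  /-- `c ~_H b` avoiding the cluster of `a`. -/
  | o2
  /-- `a ~_H b`. -/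
  | bad
  deriving DecidableEq, Fintype

/-- The avoided mark of an event. -/
def evX : Ev → Option (Fin 3)
  | .o1 => some 1
  | .o2 => some 0
  | .bad => none

/-- The source terminal of an event. -/
def evSrc : Ev → Fin 4
  | .o1 => 2
  | .o2 => 2
  | .bad => 0

/-- The destination terminal of an event. -/
def evDst : Ev → Fin 4
  | .o1 => 0
  | .o2 => 1
  | .bad => 1

/-- The sign of an event in the (★)-slack. -/
def evSign : Ev → ℤ
  | .o1 => 1
  | .o2 => 1
  | .bad => -1

/-- The six pairs of terminals. -/
def pairOf : Fin 6 → Fin 4 × Fin 4 := ![(0, 1), (0, 2), (0, 3), (1, 2), (1, 3), (2, 3)]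

/-- Every pair of distinct terminals is a `pairOf`, in one of the two orders. -/
theorem exists_pairOf (i j : Fin 4) (hij : i ≠ j) :
    ∃ l : Fin 6, pairOf l = (i, j) ∨ pairOf l = (j, i) := by
  revert i j; decide

/-- The detour matrix of a fact vector: `(i, j)` holds iff the pair-fact of `{i, j}` holds. -/
def dmat (t : Fin 7 → Bool) (i j : Fin 4) : Bool :=
  decide (∃ l : Fin 6, (pairOf l = (i, j) ∨ pairOf l = (j, i)) ∧ t l.castSucc = true)

/-- **The weight of a fact vector**: the witness condition of the mode and the reachability of the
event in the contracted H-graph. -/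
def Wcat (μ : Mode) (ev : Ev) (t : Fin 7 → Bool) : ℤ :=
  if (μ = none ∨ t 6 = true) ∧ reach4 (catMat μ (evX ev) (dmat t)) (evSrc ev) (evDst ev) then 1
  else 0

/-! ### The local facts -/

section Local

variable {C : Type} {BV BE : C → Type} [∀ τ, Fintype (BV τ)] [∀ τ, DecidableEq (BV τ)]
  [∀ τ, Fintype (BE τ)] [∀ τ, DecidableEq (BE τ)] (loc : ∀ τ, MultiGraph (Fin 4 ⊕ BV τ) (BE τ))

/-- The local fact `l` of a branch state: the detour of the pair `l` (`l < 6`), or the witness. -/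
def lfact (μ : Mode) (X : Option (Fin 3)) (l : Fin 7) (τ : C) (s : BE τ → Bool) : Prop :=
  Fin.lastCases (Wloc loc μ τ s) (fun l' : Fin 6 => Dloc loc μ τ X (pairOf l').1 (pairOf l').2 s) l

omit [∀ τ, DecidableEq (BE τ)] in
/-- The pair-facts. -/
theorem lfact_castSucc (μ : Mode) (X : Option (Fin 3)) (l' : Fin 6) (τ : C) (s : BE τ → Bool) :
    lfact loc μ X l'.castSucc τ s ↔ Dloc loc μ τ X (pairOf l').1 (pairOf l').2 s := by
  unfold lfact
  rw [Fin.lastCases_castSucc]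

omit [∀ τ, DecidableEq (BE τ)] in
/-- The witness fact. -/
theorem lfact_last (μ : Mode) (X : Option (Fin 3)) (τ : C) (s : BE τ → Bool) :
    lfact loc μ X (Fin.last 6) τ s ↔ Wloc loc μ τ s := by
  unfold lfact
  rw [Fin.lastCases_last]

omit [∀ τ, DecidableEq (BE τ)] in
/-- The witness fact, at the index `6`. -/
theorem lfact_six (μ : Mode) (X : Option (Fin 3)) (τ : C) (s : BE τ → Bool) :
    lfact loc μ X 6 τ s ↔ Wloc loc μ τ s :=
  lfact_last loc μ X τ s

/-- `lfact` is decidable. -/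
instance (μ : Mode) (X : Option (Fin 3)) (l : Fin 7) (τ : C) (s : BE τ → Bool) :
    Decidable (lfact loc μ X l τ s) :=
  Fin.lastCases (motive := fun l => Decidable (lfact loc μ X l τ s))
    (decidable_of_iff _ (lfact_last loc μ X τ s).symm)
    (fun l' => decidable_of_iff _ (lfact_castSucc loc μ X l' τ s).symm) l

/-- **The per-type count**: the states of a branch of type `τ` allowed in mode `μ` carrying no fact
of `U`. -/
def cT (μ : Mode) (X : Option (Fin 3)) (U : Finset (Fin 7)) (τ : C) : ℕ :=
  (univ.filter fun s : BE τ → Bool => allowedLoc loc μ τ s ∧ ∀ l ∈ U, ¬ lfact loc μ X l τ s).card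

end Local

/-! ### The global facts and the cell count -/

section Global

variable {C : Type} [Fintype C] [DecidableEq C] {BV BE : C → Type} [∀ τ, Fintype (BV τ)]
  [∀ τ, DecidableEq (BV τ)] [∀ τ, Fintype (BE τ)] [∀ τ, DecidableEq (BE τ)] {m : C → ℕ}
  (loc : ∀ τ, MultiGraph (Fin 4 ⊕ BV τ) (BE τ))

/-- The configurations of the gadget form a finite type. -/
instance : Fintype (Config (CE BE m)) := Pi.instFintype

/-- The allowed configurations of mode `μ`: every branch in an allowed state. -/
def Allowed (μ : Mode) (ω : Config (CE BE m)) : Prop := ∀ b : Br m, allowedLoc loc μ b.1 (brState ω b)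

/-- `Allowed` is decidable. -/
instance (μ : Mode) : DecidablePred (Allowed loc μ : Config (CE BE m) → Prop) := fun _ => by
  unfold Allowed; infer_instance

/-- The global fact `l`: some branch carries the local fact `l`. -/
def gfact (μ : Mode) (X : Option (Fin 3)) (l : Fin 7) (ω : Config (CE BE m)) : Prop :=
  ∃ b : Br m, lfact loc μ X l b.1 (brState ω b)

/-- `gfact` is decidable. -/
instance (μ : Mode) (X : Option (Fin 3)) (l : Fin 7) :
    DecidablePred (gfact loc μ X l : Config (CE BE m) → Prop) := fun _ => by
  unfold gfact; infer_instance

/-- The fact vector of a configuration. -/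
def tvec (μ : Mode) (X : Option (Fin 3)) (ω : Config (CE BE m)) : Fin 7 → Bool :=
  fun l => decide (gfact loc μ X l ω)

omit [DecidableEq C] [∀ τ, DecidableEq (BE τ)] in
/-- The detour matrix of the fact vector records the detours carried by some branch. -/
theorem dmat_tvec (μ : Mode) (X : Option (Fin 3)) (ω : Config (CE BE m)) (i j : Fin 4)
    (hij : i ≠ j) :
    (∃ b : Br m, Dloc loc μ b.1 X i j (brState ω b)) ↔ dmat (tvec loc μ X ω) i j = true := by
  unfold dmat tvec gfact
  simp only [decide_eq_true_eq, lfact_castSucc]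
  constructor
  · rintro ⟨b, hb⟩
    obtain ⟨l, hl⟩ := exists_pairOf i j hij
    refine ⟨l, hl, b, ?_⟩
    rcases hl with hl | hl
    · rw [hl]; exact hb
    · rw [hl]; exact Dloc_symm loc μ b.1 X i j _ hb
  · rintro ⟨l, hl, b, hb⟩
    rcases hl with hl | hl
    · rw [hl] at hb; exact ⟨b, hb⟩
    · rw [hl] at hb; exact ⟨b, Dloc_symm loc μ b.1 X j i _ hb⟩

omit [DecidableEq C] [∀ τ, DecidableEq (BE τ)] in
/-- The witness condition of the mode is the last fact. -/
theorem witness_iff_tvec (μ : Mode) (X : Option (Fin 3)) (ω : Config (CE BE m)) :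
    (∀ m', μ = some m' → ∃ b : Br m, att loc b.1 (brState ω b) = some m') ↔
      (μ = none ∨ tvec loc μ X ω 6 = true) := by
  unfold tvec gfact
  simp only [decide_eq_true_eq, lfact_six, Wloc]
  rcases μ with _ | m'
  · simp
  · simp only [Option.some.injEq, reduceCtorEq, false_or, forall_eq']
    constructor
    · rintro ⟨b, hb⟩
      exact ⟨b, m', rfl, hb⟩
    · rintro ⟨b, m'', hm, hb⟩
      exact ⟨b, hm ▸ hb⟩

omit [DecidableEq C] [∀ τ, DecidableEq (BE τ)] in
/-- `InMode μ` is «allowed and the witness fact». -/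
theorem inMode_iff_allowed_tvec (μ : Mode) (X : Option (Fin 3)) (ω : Config (CE BE m)) :
    InMode loc μ ω ↔ Allowed loc μ ω ∧ (μ = none ∨ tvec loc μ X ω 6 = true) := by
  rw [inMode_iff_allowed, ← witness_iff_tvec loc μ X ω]
  rfl

/-- The three events of the D-free inequality on the gadget. -/
def Event (ev : Ev) (ω : Config (CE BE m)) : Prop :=
  match ev with
  | .o1 => (catGadget loc m).HConnAvoid ω (vm 2) ((catGadget loc m).cluster ω (vm 1)) (vm 2) (vm 0)
  | .o2 => (catGadget loc m).HConnAvoid ω (vm 2) ((catGadget loc m).cluster ω (vm 0)) (vm 2) (vm 1)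
  | .bad => (catGadget loc m).HConn ω (vm 2) (vm 0) (vm 1)

omit [DecidableEq C] [∀ τ, DecidableEq (BE τ)] in
/-- **In mode `μ`, the event `ev` is the reachability of its weight.** -/
theorem event_iff_reach4 {μ : Mode} {ω : Config (CE BE m)} (hμ : InMode loc μ ω) (ev : Ev) :
    Event loc ev ω ↔
      reach4 (catMat μ (evX ev) (dmat (tvec loc μ (evX ev) ω))) (evSrc ev) (evDst ev) := by
  cases ev
  · exact event_o1_iff loc hμ _ (dmat_tvec loc μ (some 1) ω)
  · exact event_o2_iff loc hμ _ (dmat_tvec loc μ (some 0) ω)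
  · exact event_bad_iff loc hμ _ (dmat_tvec loc μ none ω)

omit [DecidableEq C] [∀ τ, DecidableEq (BE τ)] in
/-- **The indicator of «mode `μ` and the event» is the weight of the fact vector** on the allowed
configurations. -/
theorem indicator_eq_Wcat (μ : Mode) (ev : Ev) (ω : Config (CE BE m))
    [Decidable (InMode loc μ ω ∧ Event loc ev ω)] :
    (if InMode loc μ ω ∧ Event loc ev ω then (1 : ℤ) else 0) =
      if Allowed loc μ ω then Wcat μ ev (tvec loc μ (evX ev) ω) else 0 := by
  by_cases hA : Allowed loc μ ω
  · rw [if_pos hA]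
    unfold Wcat
    by_cases hμ : InMode loc μ ω
    · have hw : μ = none ∨ tvec loc μ (evX ev) ω 6 = true :=
        ((inMode_iff_allowed_tvec loc μ (evX ev) ω).1 hμ).2
      have hE' := event_iff_reach4 loc hμ ev
      by_cases hE : Event loc ev ω
      · rw [if_pos ⟨hμ, hE⟩, if_pos ⟨hw, hE'.1 hE⟩]
      · rw [if_neg (fun h => hE h.2), if_neg (fun h => hE (hE'.2 h.2))]
    · have hw : ¬ (μ = none ∨ tvec loc μ (evX ev) ω 6 = true) := fun hw =>
        hμ ((inMode_iff_allowed_tvec loc μ (evX ev) ω).2 ⟨hA, hw⟩)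
      rw [if_neg (fun h => hμ h.1), if_neg (fun h => hw h.1)]
  · rw [if_neg hA, if_neg (fun h => hA ((inMode_iff_allowed loc μ ω).1 h.1).1)]

/-- **The product count**: the allowed configurations carrying no fact of `U` are counted by the
product of the per-type counts. -/
theorem card_allowed_not_facts (μ : Mode) (X : Option (Fin 3)) (U : Finset (Fin 7)) :
    (univ.filter fun ω : Config (CE BE m) =>
      Allowed loc μ ω ∧ ∀ l ∈ U, ¬ gfact loc μ X l ω).card = ∏ τ, cT loc μ X U τ ^ m τ := by
  have h1 : (univ.filter fun ω : Config (CE BE m) =>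
      Allowed loc μ ω ∧ ∀ l ∈ U, ¬ gfact loc μ X l ω) =
      univ.filter fun ω : Config (CE BE m) => ∀ b : Br m, fibreState ω b ∈
        (univ.filter fun s : BE b.1 → Bool =>
          allowedLoc loc μ b.1 s ∧ ∀ l ∈ U, ¬ lfact loc μ X l b.1 s) := by
    ext ω
    simp only [mem_filter, mem_univ, true_and, Allowed, gfact, not_exists]
    constructor
    · rintro ⟨hA, hF⟩ b
      exact ⟨hA b, fun l hl => hF l hl b⟩
    · intro H
      exact ⟨fun b => (H b).1, fun l hl b => (H b).2 l hl⟩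
  rw [h1, card_filter_fibres_eq_prod, Fintype.prod_sigma]
  refine Finset.prod_congr rfl fun τ _ => ?_
  change ∏ _y : Fin (m τ), cT loc μ X U τ = _
  rw [Finset.prod_const, Finset.card_univ, Fintype.card_fin]

/-- **The cell polynomial** of the mode `μ` and the event `ev`. -/
def cellPoly (μ : Mode) (ev : Ev) : ℤ :=
  ∑ U : Finset (Fin 7), moebius (Wcat μ ev) U * ∏ τ, (cT loc μ (evX ev) U τ : ℤ) ^ m τ

/-- **The cell count**: the configurations in mode `μ` with the event `ev` are counted by the cell
polynomial. -/
theorem sum_indicator_eq_cellPoly (μ : Mode) (ev : Ev)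
    [∀ ω : Config (CE BE m), Decidable (InMode loc μ ω ∧ Event loc ev ω)] :
    (∑ ω : Config (CE BE m), if InMode loc μ ω ∧ Event loc ev ω then (1 : ℤ) else 0) =
      cellPoly loc (m := m) μ ev := by
  simp_rw [indicator_eq_Wcat loc μ ev]
  rw [← Finset.sum_filter]
  unfold cellPoly tvec
  rw [sum_weight_eq_moebius (Allowed loc μ) (gfact loc μ (evX ev)) (Wcat μ ev)]
  refine Finset.sum_congr rfl fun U _ => ?_
  rw [card_allowed_not_facts]
  push_cast
  rfl

end Global

end PercRepro.CatGraph
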